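import Summits.QuantumFields.YangMills.Theorems.FlatTubeReductionFibredBOCross
import HarnessLib

/-!
# Fibred Born–Oppenheimer blocks — part 7: polarisation of the DIAGONAL block — an exact identity and the model-form FLOOR WITH RATE
# (route `FlatTubeReduction`, crux K1 `NearFlatRatioLaw` stmt-QuantumFields-24720, registered stub `stub_boRate` = FCL 23943's `BORateAll`;
# rung R2b1 = RECORD-label femto gap; no summit statement is proved here)

Seat `ym-line-ftr-p1` g6 (prover).  Part 1 bounds the diagonal block from ABOVE by Cauchy–Schwarz: `T(f⊗Ω,f⊗Ω) ≤ ∫∫ (|f|√λ)k(|f|√λ)`.  The registered stub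
also needs a FLOOR (`N μ₀ e^{−Cu²} ≤ λ₀(β,L)`: a LOWER bound on the top of the true form by a product trial state), at the same second-order precision.  In the
fibred model this is POLARISATION: `B_{c,c'}(Ω_c,Ω_{c'}) = ½(λ(c) + λ(c') − ‖S_cΩ_c − S_{c'}Ω_{c'}‖²)` EXACTLY, so
`T(f⊗Ω,f⊗Ω) = ½∫∫ f(c)k(c,c')f(c')(λ(c)+λ(c')) − ½∫∫ f k f·transportSq`, and for a NONNEGATIVE slow profile (AM–GM `½(λ+λ') ≥ √λ√λ'`):
`T(f⊗Ω,f⊗Ω) ≥ ∫∫ (f√λ)k(f√λ) − ½∫∫ f(c)k(c,c')f(c')·transportSq Ω c c'` — the diagonal block is PINCHED between the dressed one-site form and the same minus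
ONE transport step (`O(β^{−1}) ≪ λ_b(L³β)²`): the floor with rate in model form, for every `f ≥ 0` (e.g. the one-site ground state at `B = L³β`).
* ★ `fibrePair_profile_eq_half` — the polarisation identity;
* ★ `fibredForm_prod_eq_polar` — the exact formula for `T(f⊗Ω,f⊗Ω)`;
* ★★ `fibredForm_prod_ge` — the lower bound (FLOOR) for `f ≥ 0`.
Integrability side conditions are hypotheses.  HONEST FRAMING: elementary algebra/measure theory for the registered stub of a crux of the CONDITIONAL reduction route
to the femto rung R2b1 (RECORD label); the chart and the frozen fibre ground states are OPEN (route RED lane A C4-CORE + the rate twin); nothing here is infinite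
volume, a continuum limit or the Clay mass gap.  No definitions, no named facts, no `sorry`.

## References
* S. J. Gustafson, I. M. Sigal, *Mathematical Concepts of Quantum Mechanics*, Springer 2003, §12 (Born–Oppenheimer: the adiabatic trial state) — [cite: GustafsonSigal2003, §12].
* M. Lüscher, Nucl. Phys. B219 (1983) 233, §3 — [cite: Luscher1983, §3].
-/

set_option autoImplicit false

noncomputable section

open MeasureTheory

namespace Summit.QuantumFields.YangMills.Theorems.FemtoTransferGap.FibredBO

variable {C Q Z : Type*} [MeasurableSpace C] [MeasurableSpace Q] [MeasurableSpace Z]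
variable {ν : Measure C} {π : Measure Q} {ρ : Measure Z} [SFinite ν] [SFinite π] [SFinite ρ]
variable {k : C → C → ℝ} {s : C → Q → Z → ℝ}

omit [MeasurableSpace C] [SFinite π] [SFinite ρ] in
/-- ★ **Polarisation**: `B_{c,c'}(Ω_c,Ω_{c'}) = ½(E_c(Ω_c) + E_{c'}(Ω_{c'}) − ‖S_cΩ_c − S_{c'}Ω_{c'}‖²)`. [folklore] -/
theorem fibrePair_profile_eq_half (Ω : C → Q → ℝ) (c c' : C) (hΩc : MemLp (halfT π s c (Ω c)) 2 ρ) (hΩc' : MemLp (halfT π s c' (Ω c')) 2 ρ) :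
    fibrePair π ρ s c c' (Ω c) (Ω c') = (fibreEnergy π ρ s c (Ω c) + fibreEnergy π ρ s c' (Ω c') - transportSq π ρ s Ω c c') / 2 := by
  have ia : Integrable (fun z => halfT π s c (Ω c) z ^ 2) ρ := hΩc.integrable_sq
  have ib : Integrable (fun z => halfT π s c' (Ω c') z ^ 2) ρ := hΩc'.integrable_sq
  have iab : Integrable (fun z => halfT π s c (Ω c) z * halfT π s c' (Ω c') z) ρ := hΩc.integrable_mul hΩc'
  have i1 : Integrable (fun z => halfT π s c (Ω c) z ^ 2 + halfT π s c' (Ω c') z ^ 2) ρ := ia.add ib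
  have i2 : Integrable (fun z => 2 * (halfT π s c (Ω c) z * halfT π s c' (Ω c') z)) ρ := iab.const_mul 2
  have hT : transportSq π ρ s Ω c c' =
      (∫ z, halfT π s c (Ω c) z ^ 2 ∂ρ) + (∫ z, halfT π s c' (Ω c') z ^ 2 ∂ρ) - 2 * ∫ z, halfT π s c (Ω c) z * halfT π s c' (Ω c') z ∂ρ := by
    unfold transportSq
    have e : ∫ z, (halfT π s c (Ω c) z - halfT π s c' (Ω c') z) ^ 2 ∂ρ =
        ∫ z, ((halfT π s c (Ω c) z ^ 2 + halfT π s c' (Ω c') z ^ 2) - 2 * (halfT π s c (Ω c) z * halfT π s c' (Ω c') z)) ∂ρ :=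
      integral_congr_ae (ae_of_all _ fun z => by ring)
    rw [e, integral_sub i1 i2, integral_add ia ib, integral_const_mul]
  unfold fibrePair fibreEnergy
  rw [hT]
  ring

omit [SFinite ν] [SFinite π] [SFinite ρ] in
/-- ★ **Exact formula for the diagonal block**: `T(f⊗Ω,f⊗Ω) = ∫∫ k(c,c')·f(c)f(c')·½(λ(c) + λ(c') − transportSq Ω c c')`, `λ(c) = E_c(Ω_c)`.
[folklore] [cite: GustafsonSigal2003, §12] -/
theorem fibredForm_prod_eq_polar (f : C → ℝ) (Ω : C → Q → ℝ) (hΩ : ∀ c, MemLp (halfT π s c (Ω c)) 2 ρ) :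
    fibredForm ν π ρ k s (fun x => f x.1 * Ω x.1 x.2) (fun x => f x.1 * Ω x.1 x.2) =
      ∫ c, ∫ c', k c c' * (f c * f c') *
        ((fibreEnergy π ρ s c (Ω c) + fibreEnergy π ρ s c' (Ω c') - transportSq π ρ s Ω c c') / 2) ∂ν ∂ν := by
  unfold fibredForm
  refine integral_congr_ae (ae_of_all _ fun c => integral_congr_ae (ae_of_all _ fun c' => ?_))
  show k c c' * fibrePair π ρ s c c' (fun q => f c * Ω c q) (fun q => f c' * Ω c' q) = _
  have e : fibrePair π ρ s c c' (fun q => f c * Ω c q) (fun q => f c' * Ω c' q) = f c * f c' * fibrePair π ρ s c c' (Ω c) (Ω c') := by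
    unfold fibrePair
    rw [← integral_const_mul]
    refine integral_congr_ae (ae_of_all _ fun z => ?_)
    dsimp only
    rw [halfT_const_mul, halfT_const_mul]
    ring
  rw [e, fibrePair_profile_eq_half Ω c c' (hΩ c) (hΩ c')]
  ring

omit [SFinite π] [SFinite ρ] in
/-- ★★ **FLOOR WITH RATE in model form**: for a nonnegative slow kernel, a NONNEGATIVE slow profile `f` and any fibre profiles `Ω_c` (`λ(c) = E_c(Ω_c)`),
`∫∫ (f√λ)(c)·k(c,c')·(f√λ)(c') − ½∫∫ f(c)k(c,c')f(c')·transportSq Ω c c' ≤ T(f⊗Ω, f⊗Ω)` — together with `fibredForm_prod_le` the diagonal block is pinched to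
within ONE transport step of the dressed one-site form. [cite: GustafsonSigal2003, §12] [cite: Luscher1983, §3] -/
theorem fibredForm_prod_ge (hk : ∀ c c', 0 ≤ k c c') (f : C → ℝ) (hf : ∀ c, 0 ≤ f c) (Ω : C → Q → ℝ)
    (hΩ : ∀ c, MemLp (halfT π s c (Ω c)) 2 ρ)
    (hI : Integrable (fun p : C × C => k p.1 p.2 * (f p.1 * f p.2) *
      ((fibreEnergy π ρ s p.1 (Ω p.1) + fibreEnergy π ρ s p.2 (Ω p.2) - transportSq π ρ s Ω p.1 p.2) / 2)) (ν.prod ν))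
    (hJ : Integrable (fun p : C × C => k p.1 p.2 * ((f p.1 * Real.sqrt (fibreEnergy π ρ s p.1 (Ω p.1))) *
      (f p.2 * Real.sqrt (fibreEnergy π ρ s p.2 (Ω p.2))))) (ν.prod ν))
    (hT : Integrable (fun p : C × C => k p.1 p.2 * (f p.1 * f p.2) * transportSq π ρ s Ω p.1 p.2) (ν.prod ν)) :
    (∫ c, ∫ c', k c c' * ((f c * Real.sqrt (fibreEnergy π ρ s c (Ω c))) * (f c' * Real.sqrt (fibreEnergy π ρ s c' (Ω c')))) ∂ν ∂ν) -
        (1 / 2) * ∫ c, ∫ c', k c c' * (f c * f c') * transportSq π ρ s Ω c c' ∂ν ∂ν ≤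
      fibredForm ν π ρ k s (fun x => f x.1 * Ω x.1 x.2) (fun x => f x.1 * Ω x.1 x.2) := by
  set lam : C → ℝ := fun c => fibreEnergy π ρ s c (Ω c) with hlam
  have hlam0 : ∀ c, 0 ≤ lam c := fun c => fibreEnergy_nonneg c (Ω c)
  -- the «mean» integrand and its integrability
  have hM : Integrable (fun p : C × C => k p.1 p.2 * (f p.1 * f p.2) * ((lam p.1 + lam p.2) / 2)) (ν.prod ν) := by
    refine (hI.add (hT.const_mul (1 / 2))).congr (ae_of_all _ fun p => ?_)
    simp only [hlam, Pi.add_apply]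
    ring
  -- pointwise AM–GM
  have hpt : ∀ p : C × C, k p.1 p.2 * ((f p.1 * Real.sqrt (lam p.1)) * (f p.2 * Real.sqrt (lam p.2))) ≤
      k p.1 p.2 * (f p.1 * f p.2) * ((lam p.1 + lam p.2) / 2) := by
    intro p
    have h1 : Real.sqrt (lam p.1) * Real.sqrt (lam p.2) ≤ (lam p.1 + lam p.2) / 2 := by
      nlinarith [sq_nonneg (Real.sqrt (lam p.1) - Real.sqrt (lam p.2)), Real.sq_sqrt (hlam0 p.1), Real.sq_sqrt (hlam0 p.2)]
    have h2 : 0 ≤ k p.1 p.2 * (f p.1 * f p.2) := mul_nonneg (hk p.1 p.2) (mul_nonneg (hf p.1) (hf p.2))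
    calc k p.1 p.2 * ((f p.1 * Real.sqrt (lam p.1)) * (f p.2 * Real.sqrt (lam p.2)))
        = k p.1 p.2 * (f p.1 * f p.2) * (Real.sqrt (lam p.1) * Real.sqrt (lam p.2)) := by ring
      _ ≤ k p.1 p.2 * (f p.1 * f p.2) * ((lam p.1 + lam p.2) / 2) := mul_le_mul_of_nonneg_left h1 h2
  -- assemble on the product measure
  rw [fibredForm_prod_eq_polar f Ω hΩ]
  have e1 : ∫ c, ∫ c', k c c' * ((f c * Real.sqrt (lam c)) * (f c' * Real.sqrt (lam c'))) ∂ν ∂ν =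
      ∫ p, k p.1 p.2 * ((f p.1 * Real.sqrt (lam p.1)) * (f p.2 * Real.sqrt (lam p.2))) ∂(ν.prod ν) := integral_integral hJ
  have e2 : ∫ c, ∫ c', k c c' * (f c * f c') * transportSq π ρ s Ω c c' ∂ν ∂ν =
      ∫ p, k p.1 p.2 * (f p.1 * f p.2) * transportSq π ρ s Ω p.1 p.2 ∂(ν.prod ν) := integral_integral hT
  have e3 : ∫ c, ∫ c', k c c' * (f c * f c') * ((lam c + lam c' - transportSq π ρ s Ω c c') / 2) ∂ν ∂ν =
      ∫ p, k p.1 p.2 * (f p.1 * f p.2) * ((lam p.1 + lam p.2 - transportSq π ρ s Ω p.1 p.2) / 2) ∂(ν.prod ν) := integral_integral hI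
  rw [e1, e2, e3]
  have hsplit : ∫ p, k p.1 p.2 * (f p.1 * f p.2) * ((lam p.1 + lam p.2 - transportSq π ρ s Ω p.1 p.2) / 2) ∂(ν.prod ν) =
      (∫ p, k p.1 p.2 * (f p.1 * f p.2) * ((lam p.1 + lam p.2) / 2) ∂(ν.prod ν)) -
        (1 / 2) * ∫ p, k p.1 p.2 * (f p.1 * f p.2) * transportSq π ρ s Ω p.1 p.2 ∂(ν.prod ν) := by
    rw [← integral_const_mul, ← integral_sub hM (hT.const_mul (1 / 2))]
    refine integral_congr_ae (ae_of_all _ fun p => ?_)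
    ring
  have hAM : ∫ p, k p.1 p.2 * ((f p.1 * Real.sqrt (lam p.1)) * (f p.2 * Real.sqrt (lam p.2))) ∂(ν.prod ν) ≤
      ∫ p, k p.1 p.2 * (f p.1 * f p.2) * ((lam p.1 + lam p.2) / 2) ∂(ν.prod ν) := integral_mono hJ hM hpt
  show (∫ p, k p.1 p.2 * ((f p.1 * Real.sqrt (lam p.1)) * (f p.2 * Real.sqrt (lam p.2))) ∂(ν.prod ν)) -
      (1 / 2) * ∫ p, k p.1 p.2 * (f p.1 * f p.2) * transportSq π ρ s Ω p.1 p.2 ∂(ν.prod ν) ≤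
    ∫ p, k p.1 p.2 * (f p.1 * f p.2) * ((lam p.1 + lam p.2 - transportSq π ρ s Ω p.1 p.2) / 2) ∂(ν.prod ν)
  rw [hsplit]
  linarith

end Summit.QuantumFields.YangMills.Theorems.FemtoTransferGap.FibredBO

end
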